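import Summits.ResolutionOfSingularities.ResolutionOfSingularities.Theorems.FrobeniusClosingSteerSwitchingExit
import Summits.ResolutionOfSingularities.ResolutionOfSingularities.Theorems.FrobeniusClosingSteerSwitchingSetup
import Summits.ResolutionOfSingularities.ResolutionOfSingularities.Theorems.FrobeniusClosingSteerDegreePTransfer
import Summits.ResolutionOfSingularities.ResolutionOfSingularities.Theorems.FrobeniusClosingSteerCore4RadicandExchange
import HarnessLib

/-!
# Crux `Steer` (stmt-ResolutionOfSingularities-16345), line `switching_dichotomy`: the TOROIDAL
# LOG-FINAL EXIT (E2 half of the registered stub `stub_logFinalExitM : ∀ p, LogFinalExitM p`,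
# skeleton r16; and the E2 disjunct of the member form `LogExit`)

OURS (campaign `res-hironaka`, rung L ★L-G4, slot W4.1, chain W4.1; unit `res-L0-w41-stub-1` g3; helper
for line `switching_dichotomy` of crux `Steer`, holder res-L0-w41-lead-1, skeleton r16; row
`stub_toroidalExitModel` of res-L0-w41-idea-2's `PLAN-LogFinalExitM.md` §2/§3, ratified by the chain
planner's SEAT TABLE v5.4; replaces the role of no printed item; NOT a statement of the manuscript under
review [claim: Hironaka2017, status: under-review]; AI-produced, which is weaker than expert review).
Theses-free and definition-free: the skeleton's vocabulary (`Concl`, `IsFracOf`, `ToroidalAt`,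
`LogFinalAt`, `LogExitAt`) is UNFOLDED into binders, so the holder's by-name leaf is definitional.

**The exit.** The radicand datum of the crux is `(A₀, t)`: `A₀ ⊆ O` a finitely generated `k`-subalgebra
of the valued field `(K, O)`, `char k = p`, `t ^ p ∈ A₀`, `Frac (A₀[t]) = K`. A local ring `S` of the
point sequence of the base along `O` is LOG-FINAL of type E2 for `t` when some EXCHANGED radicand
`t₂ ∈ K` — not a fraction of elements of `A₀` — has `t₂ ^ p` TOROIDAL in `S`:
`t₂ ^ p = (∏ z_l ^ m_l) · u` with `z` part of a regular system of parameters of `S`, `u` a unit and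
some `p ∤ m_l`. Then `(A₀, t)` has a regular model: a finitely generated `A ⊇ A₀` inside `O` with
`t ∈ A`, `Frac A = K`, regular at the centre of `O` (the skeleton's `Concl O A₀ t`).

* `toroidalExitM` — **model form** (the E2 disjunct of `LogFinalExitM p`, binders in the registered
  order): `S = locAtCentre A₁ O` for a finitely generated `A₀ ≤ A₁ ⊆ O` consisting of fractions of
  elements of `A₀`. Proof: (E2a) clear the denominator of `t₂ ^ p = a / σ` (`a, σ ∈ A₁`, `v σ = 0`)
  by passing to the radicand `t₃ := t₂ σ` (`t₃ ^ p = a σ ^ (p-1) ∈ A₁`, still not a fraction of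
  elements of `A₀`, still toroidal in `S` with the unit `u σ ^ p`); (E2b) `Frac (A₁[t₃]) = K` by the
  landed DEGREE-`p` TRANSFER `DegreePTransfer.isFractionRing_adjoin_insert_of_not_isFracOf`
  (res-L0-w41-stub-6 = res-D-pv-010, p497399: `[K : Frac A₀] ∈ {1, p}` and a prime-degree extension
  is a simple order); (E2c) `S` is regular local (it carries a regular system of parameters) and not a
  field (`z_l ≠ 0` has positive value), so the point sequence `quadraticSeq O S` of quadratic
  transforms along `O` exists (`isQuadraticTransformAlong_quadraticSeq_of_isRegularLocalRing`) and
  the landed `stub_switchingExit` (p458620) applies to the datum `(O, A₁, t₃)` at its stage `N = 0`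
  with `g = 0`; (E2d) the resulting regular model contains `t₃`, and RADICAND EXCHANGE
  `LogFinal.radicandExchange` (p483824: `t` is integral over the normal local ring at the centre)
  trades it for one containing `t`.
* `toroidalExit` — **member form** (the E2 disjunct of `LogExitAt (R M) p A₀ t` in `LogExit`): `S = R M`
  a member of the point sequence `R` of the base (`R 0 = locAtCentre A₀ O`, quadratic transforms along
  `O`). Proof: `R M = locAtCentre A' O` for a finitely generated model `A₀ ≤ A' ⊆ O` containing `t₂ ^ p`
  (`exists_model_of_mem_member`, from `exists_model_of_sequence_member`), degree-`p` transfer,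
  `stub_switchingExit` along the shifted sequence `i ↦ R (M + i)` at `N = 0`, radicand exchange.

Only `A₀.FG`, `t ^ p ∈ A₀`, `Frac (A₀[t]) = K` of the core datum are used (no perfectness of `k`, no
regularity of `A₀` at the centre). Sources: folklore (toroidal / log-regular exits: K. Kato, *Toric
singularities*, Amer. J. Math. 116 (1994), (10.4); normality of regular local rings, Matsumura Thm. 19.4).
[cite: Kato1994, (10.4)] [cite: Matsumura1987, Thm. 19.4] [folklore]
-/

noncomputable section

-- `Summit.<S>.<S>.…` duplicates the summit name by design (single-problem summit).
set_option linter.dupNamespace false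

open IsLocalRing

namespace Summit.ResolutionOfSingularities.ResolutionOfSingularities.Theorems.SwitchingDichotomy

open Literature.AlgebraicGeometry.Resolution
open Summit.ResolutionOfSingularities.ResolutionOfSingularities.Theorems.PfaffLine
  (exists_model_of_sequence_member isQuadraticTransformAlong_quadraticSeq_of_isRegularLocalRing)

namespace LogFinal

variable {k K : Type} [Field k] [Field K] [Algebra k K]

/-! ## E2, model form -/

/-- **E2 — the toroidal log-final exit, MODEL FORM** (the E2 disjunct of the registered
`LogFinalExitM p`, skeleton r16 of crux `Steer`, with `IsFracOf` / `ToroidalAt` / `Concl` unfolded).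
For `t ^ p ∈ A₀ ⊆ K` (`p` prime, `char k = p`, `A₀` finitely generated, `Frac (A₀[t]) = K`), a
finitely generated `A₁ ⊇ A₀` inside `O` consisting of fractions of elements of `A₀`, and an exchanged
radicand `t₂` — NOT a fraction of elements of `A₀` — with `t₂ ^ p = (∏ z_l ^ m_l) · u` toroidal in
`S = (A₁)_{𝔪_O ∩ A₁} ⊆ K` (`z` part of a regular system of parameters of `S`, `u` a unit, some
`p ∤ m_l`): some finitely generated `A ⊇ A₀` with `t ∈ A ⊆ O` and `Frac A = K` is regular at the centre
of `O`. [cite: Kato1994, (10.4)] [cite: Matsumura1987, Thm. 19.4] [folklore] -/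
theorem toroidalExitM (p : ℕ) (k K : Type) [Field k] [CharP k p] [Field K] [Algebra k K]
    (O : ValuationSubring K) (A₀ A₁ : Subalgebra k K) (h₀ : A₀.toSubring ≤ O.toSubring) (t : K)
    (hp : p.Prime) (hfg : A₀.FG) (htp : t ^ p ∈ A₀)
    (hfr : IsFractionRing (Algebra.adjoin k (insert t (A₀ : Set K))) K)
    (hle : A₀ ≤ A₁) (hfg₁ : A₁.FG) (hA₁ : ∀ x ∈ A₁, ∃ y ∈ A₀, ∃ z ∈ A₀, z ≠ 0 ∧ x = y / z)
    (h₁ : A₁.toSubring ≤ O.toSubring) [IsLocalRing (locAtCentre A₁.toSubring O)]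
    (t₂ : K) (ht₂ : ¬ ∃ y ∈ A₀, ∃ z ∈ A₀, z ≠ 0 ∧ t₂ = y / z)
    (s : ℕ) (z : Fin s → locAtCentre A₁.toSubring O) (hz : IsRsopPart z) (m : Fin s → ℕ)
    (hm : ∃ l, ¬ p ∣ m l) (u : locAtCentre A₁.toSubring O) (hu : IsUnit u)
    (hrel : t₂ ^ p = (∏ l, ((z l : locAtCentre A₁.toSubring O) : K) ^ m l) * (u : K)) :
    ∃ (A : Subalgebra k K) (h : A.toSubring ≤ O.toSubring), A₀ ≤ A ∧ t ∈ A ∧ A.FG ∧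
      IsFractionRing A K ∧ IsRegularLocalRing (Localization.AtPrime
        (Ideal.comap (Subring.inclusion h) (IsLocalRing.maximalIdeal O))) := by
  classical
  have _ := h₀
  have _ := hfg
  obtain ⟨l, -⟩ := id hm
  -- ### (E2c, first half) `S` is regular local, not a field: the point sequence of `A₁` along `O`
  have hregS : IsRegularLocalRing (locAtCentre A₁.toSubring O) := hz.isRegularLocalRing
  have hzm : z l ∈ maximalIdeal (locAtCentre A₁.toSubring O) := hz.mem_maximalIdeal l
  have hvz : O.valuation ((z l : locAtCentre A₁.toSubring O) : K) < 1 :=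
    (mem_maximalIdeal_locAtCentre_iff h₁ (z l)).mp hzm
  have hz0 : ((z l : locAtCentre A₁.toSubring O) : K) ≠ 0 := fun h =>
    hz.ne_zero l (Subtype.ext h)
  obtain ⟨y, hy, w, hw, hvw, hyw⟩ := mem_locAtCentre_iff.mp (z l).2
  have hy0 : y ≠ 0 := by
    rintro rfl
    exact hz0 (by rw [hyw, zero_div])
  have hvy : O.valuation y < 1 := by
    have h := hvz
    rwa [hyw, map_div₀, hvw, div_one] at h
  have hnf : ¬ IsField (locAtCentre A₁.toSubring O) :=
    not_isField_locAtCentre h₁ (B := A₁.toSubring) hy hy0 hvy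
  have hstep : ∀ i, IsQuadraticTransformAlong O (quadraticSeq O (locAtCentre A₁.toSubring O) i)
      (quadraticSeq O (locAtCentre A₁.toSubring O) (i + 1)) :=
    isQuadraticTransformAlong_quadraticSeq_of_isRegularLocalRing hregS hnf
      (subringDominates_locAtCentre h₁)
  -- ### (E2a) clear the denominator of `t₂ ^ p`: the radicand `t₃ = t₂ σ` with `t₃ ^ p ∈ A₁`
  have hsp : t₂ ^ p ∈ locAtCentre A₁.toSubring O := by
    rw [hrel]
    exact Subring.mul_mem _ (Subring.prod_mem _ fun l _ => Subring.pow_mem _ (z l).2 _) u.2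
  obtain ⟨a, ha, σ, hσ, hvσ, haσ⟩ := mem_locAtCentre_iff.mp hsp
  have hσ0 : σ ≠ 0 := ne_zero_of_valuation_eq_one hvσ
  have hσp : σ ^ p = σ ^ (p - 1) * σ := by
    rw [← pow_succ, Nat.sub_add_cancel hp.one_le]
  have ht₃p : (t₂ * σ) ^ p = t₂ ^ p * σ ^ p := mul_pow t₂ σ p
  have ht₃A : (t₂ * σ) ^ p ∈ A₁ := by
    rw [ht₃p, haσ, hσp, show a / σ * (σ ^ (p - 1) * σ) = a * σ ^ (p - 1) by field_simp]
    exact A₁.mul_mem ha (A₁.pow_mem hσ _)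
  -- `t₃` is not a fraction of elements of `A₀` (because `σ` is one)
  have ht₃ : ¬ ∃ y ∈ A₀, ∃ z ∈ A₀, z ≠ 0 ∧ t₂ * σ = y / z := by
    rintro ⟨y₃, hy₃, w₃, hw₃, hw₃0, h₃⟩
    obtain ⟨y₁, hy₁, w₁, hw₁, hw₁0, hσ₁⟩ := hA₁ σ hσ
    have hy₁0 : y₁ ≠ 0 := by
      rintro rfl
      exact hσ0 (by rw [hσ₁, zero_div])
    refine ht₂ ⟨y₃ * w₁, A₀.mul_mem hy₃ hw₁, w₃ * y₁, A₀.mul_mem hw₃ hy₁, mul_ne_zero hw₃0 hy₁0, ?_⟩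
    rw [show t₂ = t₂ * σ / σ by rw [mul_div_assoc, div_self hσ0, mul_one], h₃, hσ₁]
    field_simp
  -- ### (E2b) degree-`p` transfer: `Frac (A₁[t₃]) = K`
  have hfr₃ : IsFractionRing (Algebra.adjoin k (insert (t₂ * σ) (A₁ : Set K))) K :=
    DegreePTransfer.isFractionRing_adjoin_insert_of_not_isFracOf hp A₀ t htp hfr (t₂ * σ) ht₃ A₁ hle
  -- the toroidal presentation of `t₃ ^ p`: same `z`, `m`, unit `u σ ^ p`
  have hσS : σ ∈ locAtCentre A₁.toSubring O := le_locAtCentre _ O hσ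
  have hσu : IsUnit (⟨σ, hσS⟩ : locAtCentre A₁.toSubring O) := by
    by_contra hnu
    have hlt := (not_isUnit_locAtCentre_iff h₁ _).mp hnu
    exact absurd hvσ (ne_of_lt hlt)
  set u₃ : locAtCentre A₁.toSubring O := u * ⟨σ, hσS⟩ ^ p with hu₃_def
  have hu₃ : IsUnit u₃ := hu.mul (hσu.pow p)
  have hrel₃ : (t₂ * σ) ^ p - (0 : K) ^ p =
      (∏ l, ((z l : locAtCentre A₁.toSubring O) : K) ^ m l) * (u₃ : K) := by
    rw [zero_pow hp.ne_zero, sub_zero, ht₃p, hrel, hu₃_def]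
    push_cast
    ring
  -- ### (E2c) the landed switching exit for `(O, A₁, t₃)` at stage `N = 0` of `quadraticSeq O S`
  haveI : IsLocalRing (quadraticSeq O (locAtCentre A₁.toSubring O) 0) := ‹_›
  obtain ⟨A, h, hA₁A, -, hAfg, hAfr, hreg⟩ := stub_switchingExit p hp k K O A₁ h₁ (t₂ * σ) hfg₁ ht₃A
    hfr₃ (quadraticSeq O (locAtCentre A₁.toSubring O)) rfl hstep 0 s z hz 0 (Subring.zero_mem _) m hm
    u₃ hu₃ hrel₃
  -- ### (E2d) radicand exchange: a regular model containing `t`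
  exact radicandExchange O A₀ t hp.pos htp ⟨A, h, hle.trans hA₁A, hAfg, hAfr, hreg⟩

/-! ## E2, member form -/

-- adapted from Theorems/ValuativeLuAlphaPTorsorBirationalExit.lean (kept private: that module lies in a
-- route cone)
/-- `A₁[w] ⊆ S` for a subring `S ⊆ K` as soon as `A₁ ⊆ S` and `w ∈ S`. [folklore] -/
private theorem adjoin_insert_le_subring (S : Subring K) (A₁ : Subalgebra k K)
    (h₁ : A₁.toSubring ≤ S) {w : K} (hw : w ∈ S) :
    (Algebra.adjoin k (insert w (A₁ : Set K))).toSubring ≤ S := by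
  let Salg : Subalgebra k K :=
    { S with algebraMap_mem' := fun c => h₁ (A₁.algebraMap_mem c) }
  change Algebra.adjoin k (insert w (A₁ : Set K)) ≤ Salg
  refine Algebra.adjoin_le ?_
  rintro x (rfl | hx)
  · exact hw
  · exact h₁ hx

/-- `A₁[w]` is finitely generated when `A₁` is. [folklore] -/
private theorem fg_adjoin_insert' {A₁ : Subalgebra k K} (hfg : A₁.FG) (w : K) :
    (Algebra.adjoin k (insert w (A₁ : Set K))).FG := by
  classical
  obtain ⟨s, rfl⟩ := hfg
  rw [Algebra.adjoin_insert_adjoin, ← Finset.coe_insert]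
  exact Subalgebra.fg_adjoin_finset _

/-- **A member of the point sequence is the centre ring of a finitely generated model containing any
prescribed element of it**: for the sequence `R` of quadratic transforms along `O` of
`R 0 = (A₀)_{𝔪_O ∩ A₀}` (`A₀ ⊆ O` finitely generated) and `w ∈ R M`, some finitely generated
`A₀ ≤ A' ⊆ R M` inside `O` contains `w` and has `locAtCentre A' O = R M` (namely `A₁[w]` for the model
`A₁` of `exists_model_of_sequence_member`). [folklore] -/
theorem exists_model_of_mem_member (O : ValuationSubring K) (A₀ : Subalgebra k K)
    (h₀ : A₀.toSubring ≤ O.toSubring) (hfg : A₀.FG)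
    (R : ℕ → Subring K) (hR0 : R 0 = locAtCentre A₀.toSubring O)
    (hstep : ∀ i, IsQuadraticTransformAlong O (R i) (R (i + 1)))
    (M : ℕ) {w : K} (hw : w ∈ R M) :
    ∃ (A' : Subalgebra k K) (_ : A'.toSubring ≤ O.toSubring), A₀ ≤ A' ∧ A'.FG ∧ w ∈ A' ∧
      A'.toSubring ≤ R M ∧ locAtCentre A'.toSubring O = R M := by
  classical
  have hO : O.comap (RingHom.id K) = O := by
    ext x
    rfl
  have hS : A₀.toSubring.comap (RingHom.id K) = A₀.toSubring := by
    ext x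
    rfl
  obtain ⟨A₁, h₁, hle, hfg₁, -, hRM₁, -⟩ := exists_model_of_sequence_member k K K (RingHom.id K)
    O A₀ h₀ hfg (fun x _ => RingHom.mem_range.mpr ⟨x, rfl⟩) R (by rw [hO, hS]; exact hR0)
    (by rw [hO]; exact hstep) M
  have hRM : locAtCentre A₁.toSubring O = R M := by
    rw [← hRM₁]
    ext x
    rfl
  have hA₁R : A₁.toSubring ≤ R M := hRM ▸ le_locAtCentre A₁.toSubring O
  have hRO : R M ≤ O.toSubring := hRM ▸ locAtCentre_le h₁
  -- the model `A' = A₁[w]`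
  have hle₁ : A₁ ≤ Algebra.adjoin k (insert w (A₁ : Set K)) :=
    fun x hx => Algebra.subset_adjoin (Set.mem_insert_of_mem _ hx)
  refine ⟨Algebra.adjoin k (insert w (A₁ : Set K)), adjoin_insert_le_subring O.toSubring A₁ h₁
    (hRO hw), hle.trans hle₁, fg_adjoin_insert' hfg₁ w, Algebra.subset_adjoin (Set.mem_insert _ _),
    adjoin_insert_le_subring (R M) A₁ hA₁R hw, ?_⟩
  refine le_antisymm ?_ ?_
  · calc locAtCentre (Algebra.adjoin k (insert w (A₁ : Set K))).toSubring O
        ≤ locAtCentre (R M) O := locAtCentre_mono O (adjoin_insert_le_subring (R M) A₁ hA₁R hw)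
      _ = R M := by rw [← hRM, locAtCentre_locAtCentre]
  · rw [← hRM]
    exact locAtCentre_mono O fun x hx => hle₁ hx

/-- **E2 — the toroidal log-final exit, MEMBER FORM** (the E2 disjunct of `LogExitAt (R M) p A₀ t` in
the skeleton's `LogExit`, with `IsFracOf` / `ToroidalAt` / `Concl` unfolded). For `t ^ p ∈ A₀ ⊆ O`
(`p` prime, `char k = p`, `A₀` finitely generated, `Frac (A₀[t]) = K`), the sequence `R` of quadratic
transforms along `O` of `R 0 = (A₀)_{𝔪_O ∩ A₀}`, a local member `R M`, and an exchanged radicand `t₂`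
— NOT a fraction of elements of `A₀` — with `t₂ ^ p = (∏ z_l ^ m_l) · u` toroidal in `R M` (`z` part
of a regular system of parameters, `u` a unit, some `p ∤ m_l`): some finitely generated `A ⊇ A₀` with
`t ∈ A ⊆ O` and `Frac A = K` is regular at the centre of `O`.
[cite: Kato1994, (10.4)] [cite: Matsumura1987, Thm. 19.4] [folklore] -/
theorem toroidalExit (p : ℕ) (hp : p.Prime) (k K : Type) [Field k] [CharP k p] [Field K]
    [Algebra k K] (O : ValuationSubring K) (A₀ : Subalgebra k K) (h₀ : A₀.toSubring ≤ O.toSubring)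
    (t : K) (hfg : A₀.FG) (htp : t ^ p ∈ A₀)
    (hfr : IsFractionRing (Algebra.adjoin k (insert t (A₀ : Set K))) K)
    (R : ℕ → Subring K) (hR0 : R 0 = locAtCentre A₀.toSubring O)
    (hstep : ∀ i, IsQuadraticTransformAlong O (R i) (R (i + 1)))
    (M : ℕ) [IsLocalRing (R M)] (t₂ : K)
    (ht₂ : ¬ ∃ y ∈ A₀, ∃ z ∈ A₀, z ≠ 0 ∧ t₂ = y / z)
    (s : ℕ) (z : Fin s → R M) (hz : IsRsopPart z) (m : Fin s → ℕ) (hm : ∃ l, ¬ p ∣ m l)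
    (u : R M) (hu : IsUnit u) (hrel : t₂ ^ p = (∏ l, ((z l : R M) : K) ^ m l) * (u : K)) :
    ∃ (A : Subalgebra k K) (h : A.toSubring ≤ O.toSubring), A₀ ≤ A ∧ t ∈ A ∧ A.FG ∧
      IsFractionRing A K ∧ IsRegularLocalRing (Localization.AtPrime
        (Ideal.comap (Subring.inclusion h) (IsLocalRing.maximalIdeal O))) := by
  classical
  -- ### `t₂ ^ p ∈ R M`, and a finitely generated model `A' ∋ t₂ ^ p` with centre ring `R M`
  have hsp : t₂ ^ p ∈ R M := by
    rw [hrel]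
    exact Subring.mul_mem _ (Subring.prod_mem _ fun l _ => Subring.pow_mem _ (z l).2 _) u.2
  obtain ⟨A', h', hA₀A', hfg', hspA', -, hRM'⟩ :=
    exists_model_of_mem_member O A₀ h₀ hfg R hR0 hstep M hsp
  -- ### degree-`p` transfer: `Frac (A'[t₂]) = K`
  have hfr' : IsFractionRing (Algebra.adjoin k (insert t₂ (A' : Set K))) K :=
    DegreePTransfer.isFractionRing_adjoin_insert_of_not_isFracOf hp A₀ t htp hfr t₂ ht₂ A' hA₀A'
  -- ### the landed switching exit for the datum `(O, A', t₂)` along `i ↦ R (M + i)` at `N = 0`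
  have hrel' : t₂ ^ p - (0 : K) ^ p = (∏ l, ((z l : R M) : K) ^ m l) * (u : K) := by
    rw [zero_pow hp.ne_zero, sub_zero, hrel]
  obtain ⟨A, h, hA'A, -, hAfg, hAfr, hreg⟩ := stub_switchingExit p hp k K O A' h' t₂ hfg' hspA'
    hfr' (fun i => R (M + i)) (by simpa using hRM'.symm)
    (fun i => by simpa only [Nat.add_eq, Nat.add_assoc] using hstep (M + i)) 0 s z hz 0
    (Subring.zero_mem _) m hm u hu hrel'
  -- ### radicand exchange: a regular model containing `t`
  exact radicandExchange O A₀ t hp.pos htp ⟨A, h, hA₀A'.trans hA'A, hAfg, hAfr, hreg⟩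

end LogFinal

end Summit.ResolutionOfSingularities.ResolutionOfSingularities.Theorems.SwitchingDichotomy

end
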